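import Mathlib.NumberTheory.NumberField.AdeleRing
import Mathlib.NumberTheory.NumberField.Completion.FinitePlace
import Mathlib.RingTheory.Trace.Basic
import Mathlib.Analysis.SpecialFunctions.Complex.Circle
import Literature.NumberTheory.Automorphic.AdeleRingTopology
import Literature.NumberTheory.Automorphic.GLnAdelicStructure
import HarnessLib

/-!
# The standard additive character `ψ_K` of the adele ring `𝔸_K` of a number field

Trunk `AutomorphicAxiomatic` (G19), topic `NumberTheory/Automorphic`; namespace `Literature.Automorphic`.
Tate's global additive character (J. Tate, *Fourier analysis in number fields and Hecke's
zeta-functions*, Ch. XV of Cassels–Fröhlich, *Algebraic Number Theory* (1967), §2.2 and §4.1):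
the continuous character `ψ_K = e^{2πiΛ} : 𝔸_K → S¹`, trivial on `K`, non-trivial, with
`Λ(x) = Σ_𝔭 Λ_𝔭(x_𝔭)`, `Λ_𝔭 = λ_p ∘ Tr_{K_𝔭/ℚ_p}`, `λ_∞(x) = -x mod 1`, `λ_p(x) = ` the
`p`-fractional part. It is the input for every Whittaker / Fourier coefficient of an automorphic
form (the Jacquet–Shalika programme of `InvariantMeasureDomination`, and the `AddChar F Circle`
parameters of `TateLocalFactors`, `WhittakerModels`, `RankinSelbergLocal`).

## Construction (no local fractional parts needed)

By `𝔸_K = K + (K_∞ × ∏_v 𝒪_v)` and `K ∩ (K_∞ × ∏_v 𝒪_v) = 𝓞 K` (Tate, Lemma 4.1.3; in the tree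
`FiniteAdeleRing.exists_forall_sub_algebraMap_mem`, `exists_algebraMap_eq_of_forall_coe_mem` of
`AdeleRingTopology`) and Tate's Lemma 4.1.5 (`Λ(ξ) = 0` for `ξ ∈ K`),
`Λ(x) = -Tr_{K_∞/ℝ}(y_∞) mod ℤ` whenever `x = ξ + y` with `ξ ∈ K`, `y ∈ K_∞ × ∏_v 𝒪_v`. We take
this as the *definition*:

* `infiniteAdeleTrace K : K_∞ →+ ℝ`, `Tr_{K_∞/ℝ}(x) = Σ_w mult(w) Re(ι_w x_w)`; on principal adeles
  it is the field trace (`infiniteAdeleTrace_algebraMap`: `= Tr_{K/ℚ}`), and `Tr_{K/ℚ}(𝓞 K) ⊆ ℤ`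
  (`exists_int_trace_eq`);
* `IsFiniteIntegral K x` (`x ∈ K_∞ × ∏_v 𝒪_v`), the decomposition
  `exists_isFiniteIntegral_sub_algebraMap` and `isFiniteIntegral_algebraMap_iff`;
* `adeleTraceMod K : 𝔸_K → ℝ ⧸ ℤ` (well defined by `exists_int_infiniteAdeleTrace_sub_eq`,
  additive: `adeleTraceModHom`), and
* `adeleAddChar K : AddChar (AdeleRing (𝓞 K) K) Circle`, `ψ_K(x) = exp(-2πi · Tr_{K_∞/ℝ}(y_∞))`.

## Main results (all proved)

* `adeleAddChar_algebraMap` — `ψ_K(ξ) = 1` for `ξ ∈ K` (Tate, Lemma 4.1.5);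
* `continuous_adeleAddChar` — continuity (explicit on the open subgroup `K_∞ × ∏ 𝒪_v`, then
  translate);
* `adeleAddChar_ne_one` — non-triviality (`ψ_K = -1` on the archimedean adele `1/(2[K:ℚ])`);
* `mulShift_adeleAddChar_injective`, `mulShift_adeleAddChar_algebraMap` — the twists
  `ψ_a(x) = ψ_K(a x)`, `a ∈ K`, are pairwise distinct characters of `𝔸_K ⧸ K` (the easy half of
  Tate's Thm. 4.1.4, `K^⊥ = K`; the hard half — completeness — is left to a sequel);
* local components at finite places (through the tree's factor inclusion `adeleSingleHom K v` of
  `GLnAdelicStructure`, shown continuous in `continuous_adeleSingleHom`):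
  `adeleAddCharAt K v : AddChar (v.adicCompletion K) Circle`,
  **trivial on `𝒪_v` for every `v`** (`adeleAddCharAt_eq_one_of_mem`), continuous, and computed
  through a global approximation (`adeleAddCharAt_eq_of_sub_mem`:
  `ψ_v(x) = exp(2πi Tr_{K/ℚ}(k))` if `x ≡ k mod 𝒪_v` and `k` is integral at the other places — for
  `K = ℚ` this is Tate's `e^{2πi λ_p(x)}`). The exact conductor (`𝔡_v⁻¹`, Tate Lemma 2.2.3) is
  left to the sequel as well.

## References

* J. Tate, *Fourier analysis in number fields and Hecke's zeta-functions* (1950), in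
  J. W. S. Cassels, A. Fröhlich (eds.), *Algebraic Number Theory* (1967), Ch. XV: §2.2 (local `λ`,
  Lemma 2.2.3), §4.1 (Def. 4.1.1, Thm. 4.1.1, Lemma 4.1.3, Lemma 4.1.5, Thm. 4.1.4) — held copy
  `book:editornd-algebraic-number-theory`, PDF pp. 336, 355–359 read. [CasselsFrohlichANT1967]
* A. Deitmar, S. Echterhoff, *Principles of Harmonic Analysis*, 2nd ed. (2014), §13.3,
  Thm. 13.3.7 (`𝔸/ℚ ≅ ℚ̂` with `e_∞(x) = e^{-2πix}`) — held copy, PDF pp. 329–331 read.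

## Mathlib

Mathlib has `AddChar`, `AddCircle.toCircle`, `Circle`, the adele ring, `Algebra.trace`,
`trace_eq_sum_embeddings`, `InfinitePlace.Completion.extensionEmbedding`,
`RestrictedProduct.single`, but no additive character of a local or global field beyond `ZMod`/`ℝ`
(`lean search 'AddChar.*(adicCompletion|AdeleRing)'`: only the *parameters* `ψ : AddChar F Circle`
of the tree's `TateLocalFactors`). All declarations are in `namespace Literature.Automorphic`.
-/

noncomputable section

open NumberField IsDedekindDomain InfinitePlace

namespace Literature.NumberTheory.Automorphic

section InfiniteTrace

variable (K : Type*) [Field K] [NumberField K]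

/-- The **trace form on `K_∞`**: `Tr_{K_∞/ℝ}(x) = Σ_{w real} x_w + Σ_{w complex} 2 Re(x_w)`,
i.e. `Σ_w mult(w) · Re(ι_w(x_w))` with `ι_w : K_w → ℂ` the canonical extension of an embedding in
the class `w`. [folklore] -/
noncomputable def infiniteAdeleTrace : InfiniteAdeleRing K →+ ℝ where
  toFun x := ∑ w : InfinitePlace K, (mult w : ℝ) * (Completion.extensionEmbedding w (x w)).re
  map_zero' := Finset.sum_eq_zero fun w _ => by
    rw [show (0 : InfiniteAdeleRing K) w = 0 from rfl, map_zero, Complex.zero_re, mul_zero]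
  map_add' x y := by
    rw [← Finset.sum_add_distrib]
    refine Finset.sum_congr rfl fun w _ => ?_
    rw [show (x + y) w = x w + y w from rfl, map_add, Complex.add_re, mul_add]

/-- Unfolding of `infiniteAdeleTrace`. [folklore] -/
theorem infiniteAdeleTrace_apply (x : InfiniteAdeleRing K) :
    infiniteAdeleTrace K x =
      ∑ w : InfinitePlace K, (mult w : ℝ) * (Completion.extensionEmbedding w (x w)).re := rfl

/-- The trace form on `K_∞` is continuous. [folklore] -/
theorem continuous_infiniteAdeleTrace : Continuous (infiniteAdeleTrace K) := by
  refine continuous_finsetSum _ fun w _ => continuous_const.mul ?_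
  exact Complex.continuous_re.comp ((Completion.isometry_extensionEmbedding w).continuous.comp
    (continuous_apply w))

/-- For a principal infinite adele the trace form is the field trace:
`Tr_{K_∞/ℝ}(k) = Tr_{K/ℚ}(k)`. [folklore] -/
theorem infiniteAdeleTrace_algebraMap (k : K) :
    infiniteAdeleTrace K (algebraMap K (InfiniteAdeleRing K) k) = Algebra.trace ℚ K k := by
  classical
  rw [infiniteAdeleTrace_apply]
  -- `Σ_w mult(w) Re(σ_w k) = Re(Σ_σ σ k)`
  have h1 : ∀ w : InfinitePlace K,
      (mult w : ℝ) * (Completion.extensionEmbedding w (algebraMap K (InfiniteAdeleRing K) k w)).re =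
        ∑ φ ∈ ({φ : K →+* ℂ | mk φ = w} : Finset _), (φ k).re := by
    intro w
    have hre : ∀ φ ∈ ({φ : K →+* ℂ | mk φ = w} : Finset _), (φ k).re = (w.embedding k).re := by
      intro φ hφ
      have hφ' : mk φ = w := (Finset.mem_filter.1 hφ).2
      rcases embedding_mk_eq φ with h | h
      · rw [← hφ', h]
      · rw [← hφ', h, ComplexEmbedding.conjugate_coe_eq, Complex.conj_re]
    rw [Finset.sum_congr rfl hre, Finset.sum_const, card_filter_mk_eq, nsmul_eq_mul]
    congr 1
    change (Completion.extensionEmbedding w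
      (((WithAbs.equiv w.1).symm k : WithAbs w.1) : w.Completion)).re = _
    rw [Completion.extensionEmbedding_coe, RingEquiv.apply_symm_apply]
  rw [Finset.sum_congr rfl fun w _ => h1 w, Finset.sum_fiberwise Finset.univ mk fun φ => (φ k).re]
  have h2 : (algebraMap ℚ ℂ (Algebra.trace ℚ K k)) = ∑ σ : K →ₐ[ℚ] ℂ, σ k :=
    trace_eq_sum_embeddings ℂ
  have h3 : (∑ φ : K →+* ℂ, (φ k).re) = (∑ σ : K →ₐ[ℚ] ℂ, σ k).re := by
    rw [Complex.re_sum]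
    exact Fintype.sum_equiv RingHom.equivRatAlgHom _ _ fun φ => rfl
  rw [h3, ← h2, eq_ratCast, Complex.ratCast_re]

/-- The trace of a global integer is a rational integer. [folklore] -/
theorem exists_int_trace_eq (r : 𝓞 K) : ∃ n : ℤ, (n : ℚ) = Algebra.trace ℚ K (r : K) := by
  have h : IsIntegral ℤ (Algebra.trace ℚ K (r : K)) :=
    Algebra.isIntegral_trace (RingOfIntegers.isIntegral_coe r)
  obtain ⟨n, hn⟩ := (IsIntegrallyClosed.isIntegral_iff (R := ℤ) (K := ℚ)).1 h
  exact ⟨n, by simpa using hn⟩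

end InfiniteTrace

section IntegralAdeles

variable (K : Type*) [Field K] [NumberField K]

/-- An adele is **finite-integral** if all its finite components are local integers:
`x ∈ K_∞ × ∏_v 𝒪_v`. [folklore] -/
def IsFiniteIntegral (x : AdeleRing (𝓞 K) K) : Prop :=
  ∀ v : HeightOneSpectrum (𝓞 K), x.2 v ∈ v.adicCompletionIntegers K

/-- Finite-integral adeles are closed under addition. [folklore] -/
theorem IsFiniteIntegral.add {x y : AdeleRing (𝓞 K) K} (hx : IsFiniteIntegral K x)
    (hy : IsFiniteIntegral K y) : IsFiniteIntegral K (x + y) := fun v => by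
  change x.2 v + y.2 v ∈ _
  exact add_mem (hx v) (hy v)

/-- Finite-integral adeles are closed under negation. [folklore] -/
theorem IsFiniteIntegral.neg {x : AdeleRing (𝓞 K) K} (hx : IsFiniteIntegral K x) :
    IsFiniteIntegral K (-x) := fun v => by
  change -(x.2 v) ∈ _
  exact neg_mem (hx v)

/-- Finite-integral adeles are closed under subtraction. [folklore] -/
theorem IsFiniteIntegral.sub {x y : AdeleRing (𝓞 K) K} (hx : IsFiniteIntegral K x)
    (hy : IsFiniteIntegral K y) : IsFiniteIntegral K (x - y) := by
  simpa only [sub_eq_add_neg] using hx.add K (hy.neg K)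

/-- `0` is finite-integral. [folklore] -/
theorem isFiniteIntegral_zero : IsFiniteIntegral K 0 := fun v => by
  change (0 : v.adicCompletion K) ∈ _
  exact zero_mem _

/-- **`𝔸_K = K + (K_∞ × ∏_v 𝒪_v)`**: every adele is finite-integral up to a principal adele
(Tate, Lemma 4.1.3 (2); the tree's `FiniteAdeleRing.exists_forall_sub_algebraMap_mem`).
[cite: CasselsFrohlichANT1967, Ch. XV (Tate), Lemma 4.1.3] -/
theorem exists_isFiniteIntegral_sub_algebraMap (x : AdeleRing (𝓞 K) K) :
    ∃ k : K, IsFiniteIntegral K (x - algebraMap K (AdeleRing (𝓞 K) K) k) := by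
  obtain ⟨k, hk⟩ := FiniteAdeleRing.exists_forall_sub_algebraMap_mem (𝓞 K) K x.2
  exact ⟨k, fun v => by simpa only [AdeleRing.snd_sub, AdeleRing.algebraMap_snd] using hk v⟩

/-- **`K ∩ (K_∞ × ∏_v 𝒪_v) = 𝓞 K`**: a principal adele is finite-integral iff it is a global
integer (Tate, Lemma 4.1.3 (1)). [cite: CasselsFrohlichANT1967, Ch. XV (Tate), Lemma 4.1.3] -/
theorem isFiniteIntegral_algebraMap_iff (k : K) :
    IsFiniteIntegral K (algebraMap K (AdeleRing (𝓞 K) K) k) ↔ ∃ r : 𝓞 K, (r : K) = k := by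
  constructor
  · intro h
    obtain ⟨r, hr⟩ := exists_algebraMap_eq_of_forall_coe_mem (𝓞 K) K k fun v => h v
    exact ⟨r, hr⟩
  · rintro ⟨r, rfl⟩ v
    exact algebraMap_mem_adicCompletionIntegers (𝓞 K) K v r

/-- Two principal adeles making `x` finite-integral differ by a global integer, so the traces of
their archimedean parts differ by a rational integer. [folklore] -/
theorem exists_int_infiniteAdeleTrace_sub_eq {x : AdeleRing (𝓞 K) K} {k k' : K}
    (hk : IsFiniteIntegral K (x - algebraMap K (AdeleRing (𝓞 K) K) k))
    (hk' : IsFiniteIntegral K (x - algebraMap K (AdeleRing (𝓞 K) K) k')) :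
    ∃ n : ℤ, infiniteAdeleTrace K (x - algebraMap K (AdeleRing (𝓞 K) K) k).1 =
      infiniteAdeleTrace K (x - algebraMap K (AdeleRing (𝓞 K) K) k').1 + n := by
  -- `k' - k` is a global integer
  have hdiff : IsFiniteIntegral K (algebraMap K (AdeleRing (𝓞 K) K) (k' - k)) := by
    have := hk.sub K hk'
    simpa only [map_sub, sub_sub_sub_cancel_left] using this
  obtain ⟨r, hr⟩ := (isFiniteIntegral_algebraMap_iff K (k' - k)).1 hdiff
  obtain ⟨n, hn⟩ := exists_int_trace_eq K r
  refine ⟨n, ?_⟩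
  have hsplit : (x - algebraMap K (AdeleRing (𝓞 K) K) k).1 =
      (x - algebraMap K (AdeleRing (𝓞 K) K) k').1 +
        algebraMap K (InfiniteAdeleRing K) (k' - k) := by
    rw [AdeleRing.fst_sub, AdeleRing.fst_sub, AdeleRing.algebraMap_fst, AdeleRing.algebraMap_fst,
      map_sub]
    abel
  rw [hsplit, map_add, infiniteAdeleTrace_algebraMap, ← hr, ← hn, Rat.cast_intCast]

end IntegralAdeles

section Character

variable (K : Type*) [Field K] [NumberField K]

/-- The **fractional trace** `𝔸_K → ℝ ⧸ ℤ`: write `x = k + y` with `k ∈ K` and `y ∈ K_∞ × ∏_v 𝒪_v`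
and take `Tr_{K_∞/ℝ}(y_∞) mod ℤ` (independent of the choice by
`exists_int_infiniteAdeleTrace_sub_eq`). [folklore] -/
noncomputable def adeleTraceMod (x : AdeleRing (𝓞 K) K) : AddCircle (1 : ℝ) :=
  ((infiniteAdeleTrace K (x - algebraMap K (AdeleRing (𝓞 K) K)
    (Classical.choose (exists_isFiniteIntegral_sub_algebraMap K x))).1 : ℝ) : AddCircle (1 : ℝ))

/-- The fractional trace may be computed with *any* principal adele making `x` finite-integral.
[folklore] -/
theorem adeleTraceMod_eq {x : AdeleRing (𝓞 K) K} {k : K}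
    (hk : IsFiniteIntegral K (x - algebraMap K (AdeleRing (𝓞 K) K) k)) :
    adeleTraceMod K x =
      ((infiniteAdeleTrace K (x - algebraMap K (AdeleRing (𝓞 K) K) k).1 : ℝ) :
        AddCircle (1 : ℝ)) := by
  obtain ⟨n, hn⟩ := exists_int_infiniteAdeleTrace_sub_eq K
    (Classical.choose_spec (exists_isFiniteIntegral_sub_algebraMap K x)) hk
  unfold adeleTraceMod
  rw [hn, AddCircle.coe_add, add_eq_left, AddCircle.coe_eq_zero_iff]
  exact ⟨n, by simp⟩

/-- On finite-integral adeles the fractional trace is `Tr_{K_∞/ℝ}(x_∞) mod ℤ`. [folklore] -/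
theorem adeleTraceMod_eq_of_isFiniteIntegral {x : AdeleRing (𝓞 K) K}
    (hx : IsFiniteIntegral K x) :
    adeleTraceMod K x = ((infiniteAdeleTrace K x.1 : ℝ) : AddCircle (1 : ℝ)) := by
  rw [adeleTraceMod_eq K (k := 0) (by simpa using hx), map_zero, sub_zero]

/-- The fractional trace of `0` is `0`. [folklore] -/
theorem adeleTraceMod_zero : adeleTraceMod K 0 = 0 := by
  rw [adeleTraceMod_eq_of_isFiniteIntegral K (isFiniteIntegral_zero K),
    show (0 : AdeleRing (𝓞 K) K).1 = 0 from rfl, map_zero, AddCircle.coe_zero]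

/-- The fractional trace is additive. [folklore] -/
theorem adeleTraceMod_add (x y : AdeleRing (𝓞 K) K) :
    adeleTraceMod K (x + y) = adeleTraceMod K x + adeleTraceMod K y := by
  obtain ⟨k, hk⟩ := exists_isFiniteIntegral_sub_algebraMap K x
  obtain ⟨l, hl⟩ := exists_isFiniteIntegral_sub_algebraMap K y
  have hkl : IsFiniteIntegral K (x + y - algebraMap K (AdeleRing (𝓞 K) K) (k + l)) := by
    have := hk.add K hl
    rw [map_add]
    convert this using 1
    abel
  rw [adeleTraceMod_eq K hk, adeleTraceMod_eq K hl, adeleTraceMod_eq K hkl, ← AddCircle.coe_add,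
    ← map_add]
  congr 2
  rw [map_add]
  rw [AdeleRing.fst_sub, AdeleRing.fst_sub, AdeleRing.fst_sub]
  change x.1 + y.1 - ((algebraMap K (AdeleRing (𝓞 K) K) k).1 +
    (algebraMap K (AdeleRing (𝓞 K) K) l).1) = _
  abel

/-- The fractional trace as an additive homomorphism `𝔸_K →+ ℝ ⧸ ℤ`. [folklore] -/
noncomputable def adeleTraceModHom : AdeleRing (𝓞 K) K →+ AddCircle (1 : ℝ) where
  toFun := adeleTraceMod K
  map_zero' := adeleTraceMod_zero K
  map_add' := adeleTraceMod_add K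

/-- The fractional trace kills principal adeles. [folklore] -/
theorem adeleTraceMod_algebraMap (k : K) :
    adeleTraceMod K (algebraMap K (AdeleRing (𝓞 K) K) k) = 0 := by
  rw [adeleTraceMod_eq K (k := k) (by simpa using isFiniteIntegral_zero K), sub_self,
    show (0 : AdeleRing (𝓞 K) K).1 = 0 from rfl, map_zero, AddCircle.coe_zero]

/-- **The standard additive character of the adeles** `ψ_K : 𝔸_K → S¹`,
`ψ_K(x) = exp(-2πi · Tr_{K_∞/ℝ}(y_∞))` for `x = k + y`, `k ∈ K`, `y ∈ K_∞ × ∏_v 𝒪_v`: Tate's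
`e^{2πiΛ(x)}`, `Λ = Σ_𝔭 Λ_𝔭`, `Λ_∞(x) = -Tr x mod 1` ("note the minus sign!"), `Λ_𝔭 = λ_p ∘ Tr` the
fractional part at finite `𝔭` (equal to ours by Tate's Lemmas 4.1.3, 4.1.5). The Bochner-free,
choice-dependent intermediate `adeleTraceMod` is shown choice-independent in `adeleTraceMod_eq`.
[cite: CasselsFrohlichANT1967, Ch. XV (Tate), §2.2 and §4.1, Thm. 4.1.1] -/
noncomputable def adeleAddChar : AddChar (AdeleRing (𝓞 K) K) Circle where
  toFun x := AddCircle.toCircle (-adeleTraceMod K x)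
  map_zero_eq_one' := by rw [adeleTraceMod_zero, neg_zero, AddCircle.toCircle_zero]
  map_add_eq_mul' x y := by
    rw [adeleTraceMod_add, neg_add, AddCircle.toCircle_add]

/-- Unfolding of `adeleAddChar`: `ψ_K(x) = exp(2πi · (-adeleTraceMod x))`. [folklore] -/
theorem adeleAddChar_apply (x : AdeleRing (𝓞 K) K) :
    adeleAddChar K x = AddCircle.toCircle (-adeleTraceMod K x) := rfl

/-- On finite-integral adeles the character is `exp(-2πi Tr_{K_∞/ℝ}(x_∞))`. [folklore] -/
theorem adeleAddChar_apply_of_isFiniteIntegral {x : AdeleRing (𝓞 K) K}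
    (hx : IsFiniteIntegral K x) :
    adeleAddChar K x =
      AddCircle.toCircle (-((infiniteAdeleTrace K x.1 : ℝ) : AddCircle (1 : ℝ))) := by
  rw [adeleAddChar_apply, adeleTraceMod_eq_of_isFiniteIntegral K hx]

/-- **`ψ_K` is trivial on `K`** (Tate's Lemma 4.1.5, `Λ(ξ) = 0`; here immediate from the
construction and `Tr_{K/ℚ}(𝓞 K) ⊆ ℤ`). [cite: CasselsFrohlichANT1967, Ch. XV (Tate), Lemma 4.1.5] -/
theorem adeleAddChar_algebraMap (k : K) :
    adeleAddChar K (algebraMap K (AdeleRing (𝓞 K) K) k) = 1 := by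
  rw [adeleAddChar_apply, adeleTraceMod_algebraMap, neg_zero, AddCircle.toCircle_zero]

/-- The finite-integral adeles `K_∞ × ∏_v 𝒪_v` form an open subset of `𝔸_K`. [folklore] -/
theorem isOpen_setOf_isFiniteIntegral : IsOpen {x : AdeleRing (𝓞 K) K | IsFiniteIntegral K x} :=
  (FiniteAdeleRing.isOpen_setOf_forall_mem (𝓞 K) K).preimage continuous_snd

/-- **`ψ_K` is continuous.** [folklore] -/
theorem continuous_adeleAddChar : Continuous (adeleAddChar K) := by
  -- continuity at `0`: on the open neighbourhood `K_∞ × ∏ 𝒪_v` of `0` the character is an explicit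
  -- continuous function
  have h0 : ContinuousAt (adeleAddChar K) 0 := by
    have hev : (fun x => adeleAddChar K x) =ᶠ[nhds 0]
        fun x => AddCircle.toCircle (-((infiniteAdeleTrace K x.1 : ℝ) : AddCircle (1 : ℝ))) := by
      filter_upwards [(isOpen_setOf_isFiniteIntegral K).mem_nhds (isFiniteIntegral_zero K)]
        with x hx
      exact adeleAddChar_apply_of_isFiniteIntegral K hx
    refine (ContinuousAt.congr ?_ hev.symm)
    refine (AddCircle.continuous_toCircle.comp ?_).continuousAt
    exact ((AddCircle.continuous_mk' (1 : ℝ)).comp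
      ((continuous_infiniteAdeleTrace K).comp continuous_fst)).neg
  refine continuous_iff_continuousAt.2 fun x₀ => ?_
  have heq : ⇑(adeleAddChar K) = fun x => adeleAddChar K x₀ * adeleAddChar K (x - x₀) := by
    funext x
    rw [← AddChar.map_add_eq_mul, add_sub_cancel]
  rw [heq]
  refine continuousAt_const.mul ?_
  have hsub : ContinuousAt (fun x : AdeleRing (𝓞 K) K => x - x₀) x₀ :=
    (continuous_sub_right x₀).continuousAt
  have : ContinuousAt (adeleAddChar K) ((fun x : AdeleRing (𝓞 K) K => x - x₀) x₀) := by
    simpa only [sub_self] using h0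
  exact ContinuousAt.comp this hsub

/-- **`ψ_K` is non-trivial**: on the archimedean adele `(1/(2[K:ℚ]), 0)` it takes the value
`exp(-πi) = -1`. [folklore] -/
theorem adeleAddChar_ne_one :
    adeleAddChar K
      (algebraMap K (InfiniteAdeleRing K) ((2 * Module.finrank ℚ K : ℚ)⁻¹ : ℚ), 0) ≠ 1 := by
  set c : ℚ := (2 * Module.finrank ℚ K : ℚ)⁻¹ with hc
  have hfi : IsFiniteIntegral K (algebraMap K (InfiniteAdeleRing K) (c : K), 0) := fun v => by
    change (0 : FiniteAdeleRing (𝓞 K) K) v ∈ _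
    exact (isFiniteIntegral_zero K) v
  rw [adeleAddChar_apply_of_isFiniteIntegral K hfi, ne_eq, ← AddCircle.toCircle_zero,
    (AddCircle.injective_toCircle one_ne_zero).eq_iff, neg_eq_zero, AddCircle.coe_eq_zero_iff]
  rintro ⟨n, hn⟩
  have htr : infiniteAdeleTrace K (algebraMap K (InfiniteAdeleRing K) (c : K)) = 1 / 2 := by
    rw [infiniteAdeleTrace_algebraMap, show (c : K) = algebraMap ℚ K c from (eq_ratCast _ c).symm,
      Algebra.trace_algebraMap, nsmul_eq_mul, hc]
    have hd : (Module.finrank ℚ K : ℝ) ≠ 0 := Nat.cast_ne_zero.2 Module.finrank_pos.ne'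
    push_cast
    field_simp
  rw [htr, zsmul_eq_mul, mul_one] at hn
  have h2 : (2 * n : ℤ) = (1 : ℤ) := by exact_mod_cast (by linarith : (2 * n : ℝ) = 1)
  omega

/-- The twists `ψ_a(x) = ψ_K(a x)`, `a ∈ K`, are pairwise distinct characters of `𝔸_K` (all trivial
on `K`): `a ↦ ψ_a` is injective — the injectivity half of Tate's Thm. 4.1.4 (`K^⊥ = K`).
[cite: CasselsFrohlichANT1967, Ch. XV (Tate), Thm. 4.1.4] -/
theorem mulShift_adeleAddChar_injective :
    Function.Injective fun a : K =>
      (adeleAddChar K).mulShift (algebraMap K (AdeleRing (𝓞 K) K) a) := by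
  intro a b hab
  by_contra hne
  have hab' : ∀ y, adeleAddChar K (algebraMap K (AdeleRing (𝓞 K) K) a * y) =
      adeleAddChar K (algebraMap K (AdeleRing (𝓞 K) K) b * y) := fun y => by
    have := congrArg (fun ψ : AddChar (AdeleRing (𝓞 K) K) Circle => ψ y) hab
    simpa only [AddChar.mulShift_apply] using this
  set x₀ : AdeleRing (𝓞 K) K :=
    (algebraMap K (InfiniteAdeleRing K) ((2 * Module.finrank ℚ K : ℚ)⁻¹ : ℚ), 0) with hx₀
  set c : AdeleRing (𝓞 K) K := algebraMap K (AdeleRing (𝓞 K) K) (a - b)⁻¹ with hc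
  have hinv : algebraMap K (AdeleRing (𝓞 K) K) (a - b) * c = 1 := by
    rw [hc, ← map_mul, mul_inv_cancel₀ (sub_ne_zero.2 hne), map_one]
  have hsplit : algebraMap K (AdeleRing (𝓞 K) K) a * (c * x₀) =
      algebraMap K (AdeleRing (𝓞 K) K) b * (c * x₀) + x₀ := by
    calc algebraMap K (AdeleRing (𝓞 K) K) a * (c * x₀)
        = (algebraMap K (AdeleRing (𝓞 K) K) b + algebraMap K (AdeleRing (𝓞 K) K) (a - b)) *
            (c * x₀) := by rw [← map_add, add_sub_cancel]
      _ = algebraMap K (AdeleRing (𝓞 K) K) b * (c * x₀) +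
            algebraMap K (AdeleRing (𝓞 K) K) (a - b) * c * x₀ := by ring
      _ = algebraMap K (AdeleRing (𝓞 K) K) b * (c * x₀) + x₀ := by rw [hinv, one_mul]
  have key := hab' (c * x₀)
  rw [hsplit, AddChar.map_add_eq_mul, mul_eq_left] at key
  exact adeleAddChar_ne_one K key

/-- `ψ_a` is trivial on `K` for every `a ∈ K`. [folklore] -/
theorem mulShift_adeleAddChar_algebraMap (a k : K) :
    (adeleAddChar K).mulShift (algebraMap K (AdeleRing (𝓞 K) K) a)
      (algebraMap K (AdeleRing (𝓞 K) K) k) = 1 := by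
  rw [AddChar.mulShift_apply, ← map_mul, adeleAddChar_algebraMap]

end Character

section Local

variable (K : Type) [Field K] [NumberField K] (v : HeightOneSpectrum (𝓞 K))

/-- A local element placed at `v` (the tree's factor inclusion `adeleSingleHom K v : K_v →ₙ+* 𝔸_K`
of `GLnAdelicStructure`) is a finite-integral adele iff it is a local integer. [folklore] -/
theorem isFiniteIntegral_adeleSingleHom_iff (x : v.adicCompletion K) :
    IsFiniteIntegral K (adeleSingleHom K v x) ↔ x ∈ v.adicCompletionIntegers K := by
  constructor
  · intro h
    simpa only [adeleSingleHom_apply_snd, finiteAdeleSingleHom_apply_self] using h v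
  · intro hx w
    rw [adeleSingleHom_apply_snd]
    by_cases hw : w = v
    · subst hw; rwa [finiteAdeleSingleHom_apply_self]
    · rw [finiteAdeleSingleHom_apply_of_ne K v x hw]; exact zero_mem _

/-- The **local component `ψ_v`** of the standard character at a finite place `v`:
`ψ_v(x) = ψ_K(…, 0, x, 0, …)` (composition with `adeleSingleHom K v`). [folklore] -/
def adeleAddCharAt : AddChar (v.adicCompletion K) Circle :=
  (adeleAddChar K).compAddMonoidHom (adeleSingleHom K v : v.adicCompletion K →+ AdeleRing (𝓞 K) K)

/-- Unfolding of `adeleAddCharAt`. [folklore] -/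
theorem adeleAddCharAt_apply (x : v.adicCompletion K) :
    adeleAddCharAt K v x = adeleAddChar K (adeleSingleHom K v x) := rfl

/-- **`ψ_v` is trivial on `𝒪_v`** (for every finite `v`). [folklore] -/
theorem adeleAddCharAt_eq_one_of_mem {x : v.adicCompletion K}
    (hx : x ∈ v.adicCompletionIntegers K) :
    adeleAddCharAt K v x = 1 := by
  rw [adeleAddCharAt_apply, adeleAddChar_apply_of_isFiniteIntegral K
    ((isFiniteIntegral_adeleSingleHom_iff K v x).2 hx), adeleSingleHom_apply_fst, map_zero,
    AddCircle.coe_zero, neg_zero, AddCircle.toCircle_zero]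

/-- **The local component through a global approximation**: if `k ∈ K` is `v`-adically congruent to
`x` modulo `𝒪_v` and integral at all other finite places, then `ψ_v(x) = exp(2πi Tr_{K/ℚ}(k))`
(for `K = ℚ`: `ψ_p(x) = e^{2πi λ_p(x)}` with Tate's `λ_p`, PDF p. 336 of the held copy).
[cite: CasselsFrohlichANT1967, Ch. XV (Tate), §2.2] -/
theorem adeleAddCharAt_eq_of_sub_mem {x : v.adicCompletion K} {k : K}
    (hv : x - (k : v.adicCompletion K) ∈ v.adicCompletionIntegers K)
    (hw : ∀ w : HeightOneSpectrum (𝓞 K), w ≠ v →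
      (k : w.adicCompletion K) ∈ w.adicCompletionIntegers K) :
    adeleAddCharAt K v x =
      AddCircle.toCircle (((Algebra.trace ℚ K k : ℚ) : ℝ) : AddCircle (1 : ℝ)) := by
  have hfi : IsFiniteIntegral K (adeleSingleHom K v x - algebraMap K (AdeleRing (𝓞 K) K) k) := by
    intro w
    change (adeleSingleHom K v x).2 w - (algebraMap K (AdeleRing (𝓞 K) K) k).2 w ∈ _
    rw [AdeleRing.algebraMap_snd, adeleSingleHom_apply_snd]
    by_cases hwv : w = v
    · subst hwv; rwa [finiteAdeleSingleHom_apply_self]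
    · rw [finiteAdeleSingleHom_apply_of_ne K v x hwv, zero_sub]
      exact neg_mem (hw w hwv)
  rw [adeleAddCharAt_apply, adeleAddChar_apply, adeleTraceMod_eq K hfi, AdeleRing.fst_sub,
    adeleSingleHom_apply_fst, zero_sub, map_neg, AdeleRing.algebraMap_fst,
    infiniteAdeleTrace_algebraMap, AddCircle.coe_neg, neg_neg]

open RestrictedProduct Filter in
/-- The factor inclusion `adeleSingleHom K v : K_v → 𝔸_K` is continuous (it factors through the open
principal piece `Πʳ_[𝓟 {v}ᶜ]` of `𝔸_K^∞`, whose topology is the product topology). [folklore] -/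
theorem continuous_adeleSingleHom : Continuous (adeleSingleHom K v) := by
  classical
  refine continuous_prodMk.2 ⟨continuous_const, ?_⟩
  change Continuous fun x => (adeleSingleHom K v x).2
  have hS : (cofinite : Filter (HeightOneSpectrum (𝓞 K))) ≤ 𝓟 ({v}ᶜ : Set _) :=
    le_principal_iff.2 (Set.finite_singleton v).compl_mem_cofinite
  let f : v.adicCompletion K → Πʳ w : HeightOneSpectrum (𝓞 K),
      [w.adicCompletion K, w.adicCompletionIntegers K]_[𝓟 ({v}ᶜ : Set _)] := fun x =>
    ⟨Pi.single v x, by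
      simp only [eventually_principal, Set.mem_compl_iff, Set.mem_singleton_iff]
      intro w hw
      rw [Pi.single_eq_of_ne hw]
      exact zero_mem _⟩
  have hf : Continuous f := by
    rw [continuous_rng_of_principal]
    exact continuous_single v
  have heq : (fun x => (adeleSingleHom K v x).2) = inclusion _ _ hS ∘ f := by
    funext x; rfl
  rw [heq]
  exact (continuous_inclusion hS).comp hf

/-- `ψ_v` is continuous. [folklore] -/
theorem continuous_adeleAddCharAt : Continuous (adeleAddCharAt K v) :=
  (continuous_adeleAddChar K).comp (continuous_adeleSingleHom K v)

end Local

end Literature.NumberTheory.Automorphic
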